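import Summits.QuantumFields.YangMills.Theorems.AlphaInputsT3ACv3StartDefectCore
import Summits.QuantumFields.YangMills.Theorems.AlphaInputsT3ACv3RegionAxialGauge
import Summits.QuantumFields.YangMills.Theorems.AlphaInputsT3ACv3FLContractionCore
import Literature.MathematicalPhysics.QuantumFieldTheory.Balaban1983to89.BlockAveragingSectionAction
import HarnessLib

/-!
# `AlphaInputsT3ACv3StartDefectBox` — non-abelian (FL), START v3 row (S6) «the defect of the START is `O(ε)`, k-free», BOX FORM: **★alpha-2 g6's two-gauge defect core composed with ★w1 g0's
# regional comb-axial gauge at the FINEST level on the two-cell box of a coarse bond** — for finest fields `U` (the START) and `W` (the section, FLAT on the box) and a level-`k` bond `c`: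
# if the plaquettes of `U` with corners in a product set containing the comb fans of the two `k`-blocks of `c` are `≤ b′`, those of `W` there are trivial, and `U`, `W` have the SAME
# transport along the comb from the centre `ĉ₋` to the centre `ĉ₊` (the straight centre line, which meets no tube and no ball of START v3), then
# `‖avg^k U(c)·(avg^k W(c))* − 1‖ ≤ 2(d+1)L^k·(D·b′)` with `D` the `l¹`-radius of the two blocks seen from `ĉ₋` (`≍ 2dL^k`): `O(d²·L^{2k}·b′) = O(d²ε)` for `b′ = 64εL^{−2k}` —
# cell `ym3-torus`, width seat `ym-ust-19936-w5` (g2), row (S6) of ★w1-19936 g2 LEAD memo `NONABELIAN-FL-START-w1-g2.md` §3 (D)∕§4 (OWNER 02:16:33Z∕02:24:53Z: (S6) → this seat after (S3))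

WHY.  Memo §3 (D): «for `c ∈ bondsIn k Ω` the two cells of c contain NO corner-line plaquette, so `U⁰` restricted to the two-cell box has ALL plaquettes `≤ b` ⇒ fine comb-axial gauge `σ_c` on
the box: `‖(U⁰)^{σ_c} − 1‖ ≤ 2dL^k·b =: δ` ⇒ R1 … ; the same for `W₀` (FLAT on the box ⇒ `W₀^{σ⁰_c} ≡ 1`, `avg^k = 1`, `V(c) = σ⁰(ĉ₋)⁻¹σ⁰(ĉ₊)`); `σ_c` vs `σ⁰_c` along a comb path differ by the
product of `U⁰W₀⁻¹` over ≤ O(d) tube/ball crossings».  ★alpha-2 g6's ✓ p599380 `StartDefectCore.norm_defect_sub_one_le_of_twoGauges` IS that shape abstractly (gauges `σ, σ₀`, set `S ⊇` the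
two blocks, `hτ` on the centre values); ★w1 g0's ✓ p586049 `RegionAxialGauge.dist1_gaugeActT_axialT_le_of_box` IS the box axial gauge at any level.  THIS FILE composes them with
`σ := axialT U ĉ₋`, `σ₀ := axialT W ĉ₋` — both based at the centre `ĉ₋ = toFine k c₋`, so `σ(ĉ₋) = σ₀(ĉ₋) = 1` and `hτ` reads `W(Γ_{ĉ₋ĉ₊})·U(Γ_{ĉ₋ĉ₊})⁻¹ − 1`: it VANISHES when `U = W`
along the comb `Γ_{ĉ₋ĉ₊}` (the straight centre line — in START v3 it is at distance `≍ L^k/2` from every edge tube (radius `r ≍ L^k/8`) and vertex cube (half-side `R ≍ L^k/4`), so `U⁰ =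
iterSec k V` there: SHARPER than «≤ O(d) crossings», τ = 0).  With `W := iterSec k V` the second average IS `V` (`BlockAveragingSectionAction.iter_iterSec`), giving (D) verbatim.
WHAT.  §1 `axialT_congr_of_walk` (two fields agreeing on the bonds of the comb have the same axial transport — `T4ReflectionCone.holAt_congr`), `transfUp_axialT_base` (`= 1` at the base
centre), `gaugeAct_axialT_eq_one_of_flat` (a field FLAT on the box is TRIVIAL in its box axial gauge: the `δ = 0` case of ★w1's lemma); §2 ★★ `norm_defect_sub_one_le_of_box` (the
composition, binders = ★w1's box rows for every bond of the two blocks + `hline`); §3 ★★★ `norm_startDefect_sub_one_le_of_box` (`W := iterSec k V`: `‖avg^k U(c)·V(c)* − 1‖ ≤ 2(d+1)L^k·D·b′`).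
The geometric discharges (the two blocks' comb fans lie in the two-cell product box, non-wrapping for `4L^k < sitesPerDir 0`, `D ≤ 2dL^k`, and `U⁰ = iterSec` on the centre line from
(S5)'s `startU_apply_of_quiet`) are (S5)-4's box facts and stay binders here (LEAD 03:24:30Z: `dist1_plaqHol_startU_le`, `startU_apply_of_quiet`).
HONEST FRAMING.  Composition of landed kernel lemmas; count-neutral helper toward R3 2′ (items 19936∕19935, `--supports stmt-QuantumFields-19936`); `hLift`∕(FL), the stub
`stub_laneRecordsV3Chi`, the crux `HistoryTailL` and the gap are NOT claimed; registry untouched; YM₃ on T³ is rung R3 of the YM ladder, not the Clay problem.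

References: T. Bałaban, Commun. Math. Phys. 98 (1985) 17–51 [Balaban1985Averaging] ((8)–(9) p.18, (11)–(13) p.19, Prop. 4 (134)–(135) p.38, pp.24–25); Commun. Math. Phys. 102 (1985)
277–309 [Balaban1985Variational] (Thm 1 (8) p.279, (11)–(13) pp.279–280, (18) p.280); Commun. Math. Phys. 109 (1987) 249–301 [Balaban1987RG1] ((0.11) p.253).
-/

set_option autoImplicit false

noncomputable section

open scoped Matrix.Norms.L2Operator
open NormedSpace

namespace Summit.QuantumFields.YangMills.Theorems.StartDefectBox

open Literature.MathematicalPhysics.QuantumFieldTheory.Balaban1983to89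
open T4Continuum BlockAveraging ExpMeanLog
open Literature.MathematicalPhysics.QuantumFieldTheory.Balaban1983to89.B5Eq118OneStroke (iterBlockOf)
open Literature.MathematicalPhysics.QuantumFieldTheory.Balaban1983to89.B10Eq38TorusDomains (toFine)
open Literature.MathematicalPhysics.QuantumFieldTheory.Balaban1983to89.B10Eq27TorusAxialLog (holT axialT gaugeActT rel holT_eq_holAt axialT_self)
open Literature.MathematicalPhysics.QuantumFieldTheory.Balaban1983to89.B7Prop1Explicit (treeWord l1 e)
open Literature.MathematicalPhysics.QuantumFieldTheory.Balaban1983to89.BlockAveragingSectionAction (iterSec iter_iterSec)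
open Literature.MathematicalPhysics.QuantumFieldTheory.Balaban1983to89.T3DescentFibreTower (expMeanLogSU_E_one)
open Summit.QuantumFields.YangMills.Theorems.FLContraction (transfUp_eq_toFine)
open Summit.QuantumFields.YangMills.Theorems.RegionAxialGauge (dist1_gaugeActT_axialT_le_of_box)
open Summit.QuantumFields.YangMills.Theorems.StartDefectCore (norm_defect_sub_one_le_of_twoGauges)

variable {P : Params}

/-! ## §1 Letters on the axial gauge -/

section Letters

variable {G : Type*} [GaugeGroup G]

/-- **TWO FIELDS AGREEING ON THE COMB HAVE THE SAME AXIAL TRANSPORT**: if `U = W` on every bond of the comb walk from `y` to `x`, then `axialT U y x = axialT W y x`.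
[cite: Balaban1985Averaging, (8)–(9) p.18, pp.24–25] -/
theorem axialT_congr_of_walk {j : ℕ} (U W : GaugeField P j G) (y x : Site P j) (h : ∀ s ∈ walk y (treeWord (rel y x)), U s.bond = W s.bond) :
    axialT U y x = axialT W y x := by
  unfold axialT
  rw [holT_eq_holAt, holT_eq_holAt]
  exact T4ReflectionCone.holAt_congr h

/-- The axial gauge based at the centre `ĉ₋ = toFine k c₋`, restricted up the levels, is `1` at `c₋`. [cite: Balaban1985Averaging, (11)–(13) p.19] -/
theorem transfUp_axialT_base {k : ℕ} (U : GaugeField P 0 G) (c : PBond P k) : transfUp (axialT U (toFine k c.src)) k c.src = 1 := by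
  rw [transfUp_eq_toFine, axialT_self]

/-- The axial gauge based at `ĉ₋`, restricted up the levels, reads `axialT U ĉ₋ ĉ₊` at `c₊`. [cite: Balaban1985Averaging, (11)–(13) p.19] -/
theorem transfUp_axialT_tgt {k : ℕ} (U : GaugeField P 0 G) (c : PBond P k) : transfUp (axialT U (toFine k c.src)) k c.tgt = axialT U (toFine k c.src) (toFine k c.tgt) := by
  rw [transfUp_eq_toFine]

end Letters

section SU

variable {n : Type*} [Fintype n] [DecidableEq n] [Nonempty n]

/-- **A FIELD FLAT ON THE BOX IS TRIVIAL IN ITS BOX AXIAL GAUGE** (`SU(n)`): the `δ = 0` case of ★w1's regional axial gauge — if every plaquette of `W` with corners in the product set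
is `1`, then `W^{axialT W y}_b = 1` at every bond whose comb fan lies in the set. [cite: Balaban1985Averaging, pp.24–25; Balaban1985Variational, (18) p.280] -/
theorem gaugeAct_axialT_eq_one_of_flat {j : ℕ} (W : GaugeField P j (Matrix.specialUnitaryGroup n ℂ)) {I : Fin P.d → Set (ZMod (P.sitesPerDir j))}
    (hW : ∀ q : Plaq P j, q.src ∈ {z : Site P j | ∀ κ, z κ ∈ I κ} → (q.src.shift q.μ).shift q.ν ∈ {z : Site P j | ∀ κ, z κ ∈ I κ} → dist1 (GaugeField.plaqHol W q) ≤ 0)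
    (y x : Site P j) (μ : Fin P.d) (hwrap : (rel y x μ + 1) * 2 ≤ (P.sitesPerDir j : ℤ))
    (hbox : ∀ (κ : Fin P.d) (t : ℤ), min 0 (min (rel y x κ) ((rel y x + e μ) κ)) ≤ t → t ≤ max 0 (max (rel y x κ) ((rel y x + e μ) κ)) →
      y κ + ((t : ℤ) : ZMod (P.sitesPerDir j)) ∈ I κ) :
    GaugeField.gaugeAct (axialT W y) W ⟨x, μ⟩ = 1 := by
  have h := dist1_gaugeActT_axialT_le_of_box W le_rfl hW y x μ hwrap hbox
  rw [mul_zero] at h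
  have h0 : dist1 (gaugeActT (axialT W y) W ⟨x, μ⟩) = 0 := le_antisymm h (GaugeGroup.dist1_nonneg _)
  rw [FederbushMean.dist1_SU_eq, norm_eq_zero, sub_eq_zero] at h0
  exact Subtype.ext (by rw [OneMemClass.coe_one]; exact h0)

/-! ## §2 The composed defect bound -/

/-- **★★ THE DEFECT OF `U` AGAINST THE AVERAGES OF A BOX-FLAT `W`, FROM BOX PLAQUETTES** (`k ≤ m + K`): with `ĉ₋ = toFine k c₋` and `S` = the two `k`-blocks of `c`: if for every
finest bond `⟨x, μ⟩` with both ends in `S` the comb fan from `ĉ₋` does not wrap (`hwrap`) and lies in the product set `I` (`hfan`), the `l¹`-distance from `ĉ₋` is `≤ D` on `S` (`hl1`),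
the plaquettes of `U` with corners in `I` are `≤ b′` and those of `W` are `1`, and `U`, `W` have the same axial transport `ĉ₋ → ĉ₊` (`hline`), then — under R1's k-free rows at
`δ := D·b′` — `‖avg^k U(c)·(avg^k W(c))* − 1‖ ≤ 2(d+1)L^k·(D·b′)`. [cite: Balaban1985Averaging, Prop. 4 (134)–(135) p.38, pp.24–25; Balaban1985Variational, (11)–(13) pp.279–280] -/
theorem norm_defect_sub_one_le_of_box {k : ℕ} (hk : k ≤ P.m + P.K) (U W : GaugeField P 0 (Matrix.specialUnitaryGroup n ℂ)) (c : PBond P k)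
    {I : Fin P.d → Set (ZMod (P.sitesPerDir 0))} {b' : ℝ} (hb' : 0 ≤ b') {D : ℕ}
    (hU : ∀ q : Plaq P 0, q.src ∈ {z : Site P 0 | ∀ κ, z κ ∈ I κ} → (q.src.shift q.μ).shift q.ν ∈ {z : Site P 0 | ∀ κ, z κ ∈ I κ} → dist1 (GaugeField.plaqHol U q) ≤ b')
    (hW : ∀ q : Plaq P 0, q.src ∈ {z : Site P 0 | ∀ κ, z κ ∈ I κ} → (q.src.shift q.μ).shift q.ν ∈ {z : Site P 0 | ∀ κ, z κ ∈ I κ} → dist1 (GaugeField.plaqHol W q) ≤ 0)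
    (hwrap : ∀ x : Site P 0, (iterBlockOf k x = c.src ∨ iterBlockOf k x = c.tgt) → ∀ μ : Fin P.d, (rel (toFine k c.src) x μ + 1) * 2 ≤ (P.sitesPerDir 0 : ℤ))
    (hfan : ∀ x : Site P 0, (iterBlockOf k x = c.src ∨ iterBlockOf k x = c.tgt) → ∀ μ : Fin P.d, (iterBlockOf k (x.shift μ) = c.src ∨ iterBlockOf k (x.shift μ) = c.tgt) →
      ∀ (κ : Fin P.d) (t : ℤ), min 0 (min (rel (toFine k c.src) x κ) ((rel (toFine k c.src) x + e μ) κ)) ≤ t →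
        t ≤ max 0 (max (rel (toFine k c.src) x κ) ((rel (toFine k c.src) x + e μ) κ)) → (toFine k c.src) κ + ((t : ℤ) : ZMod (P.sitesPerDir 0)) ∈ I κ)
    (hl1 : ∀ x : Site P 0, (iterBlockOf k x = c.src ∨ iterBlockOf k x = c.tgt) → l1 (rel (toFine k c.src) x) ≤ D)
    (hline : axialT U (toFine k c.src) (toFine k c.tgt) = axialT W (toFine k c.src) (toFine k c.tgt))
    (hm : (((P.d : ℝ) + 1) * ((18 : ℝ) ^ P.d * (2 + ((P.d : ℝ) + 1) * (18 : ℝ) ^ P.d)) * (324 * (((P.d + 2) * P.L : ℕ) : ℝ) ^ 2) /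
        ((P.L : ℝ) * ((P.L : ℝ) - 1))) * (((P.d : ℝ) + 1) * (P.L : ℝ) ^ k * ((D : ℝ) * b')) ≤ 1)
    (h32 : 32 * (((P.d + 2) * P.L : ℕ) : ℝ) * (((P.d : ℝ) + 1) * (P.L : ℝ) ^ k * ((D : ℝ) * b')) ≤ 1)
    (hN : 4 * (((P.d + 2) * P.L : ℕ) : ℝ) * (((P.d : ℝ) + 1) * (P.L : ℝ) ^ k * ((D : ℝ) * b')) < deltaSU n) :
    ‖((Averaging.iter (fun i => (blockAvg (expMeanLogSU (n := n)) : Averaging P i (Matrix.specialUnitaryGroup n ℂ))) k U c : Matrix.specialUnitaryGroup n ℂ) : Matrix n n ℂ) *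
        star ((Averaging.iter (fun i => (blockAvg (expMeanLogSU (n := n)) : Averaging P i (Matrix.specialUnitaryGroup n ℂ))) k W c : Matrix.specialUnitaryGroup n ℂ) : Matrix n n ℂ) - 1‖ ≤
      2 * (((P.d : ℝ) + 1) * (P.L : ℝ) ^ k * ((D : ℝ) * b')) := by
  set S : Set (Site P 0) := {x | iterBlockOf k x = c.src ∨ iterBlockOf k x = c.tgt} with hS
  have hδ : 0 ≤ (D : ℝ) * b' := by positivity
  -- the two gauges
  have hUσ : ∀ b : PBond P 0, b.src ∈ S → b.tgt ∈ S →
      ‖((GaugeField.gaugeAct (axialT U (toFine k c.src)) U b : Matrix.specialUnitaryGroup n ℂ) : Matrix n n ℂ) - 1‖ ≤ (D : ℝ) * b' := by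
    rintro ⟨x, μ⟩ hx hx'
    have h := dist1_gaugeActT_axialT_le_of_box U hb' hU (toFine k c.src) x μ (hwrap x hx μ) (hfan x hx μ hx')
    rw [← FederbushMean.dist1_SU_eq]
    refine h.trans (mul_le_mul_of_nonneg_right ?_ hb')
    exact_mod_cast hl1 x hx
  have hWσ : ∀ b : PBond P 0, b.src ∈ S → b.tgt ∈ S → GaugeField.gaugeAct (axialT W (toFine k c.src)) W b = 1 := by
    rintro ⟨x, μ⟩ hx hx'
    exact gaugeAct_axialT_eq_one_of_flat W hW (toFine k c.src) x μ (hwrap x hx μ) (hfan x hx μ hx')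
  -- the centre values: τ = 0
  have hprod : transfUp (axialT U (toFine k c.src)) k c.src * (transfUp (axialT W (toFine k c.src)) k c.src)⁻¹ * transfUp (axialT W (toFine k c.src)) k c.tgt *
      (transfUp (axialT U (toFine k c.src)) k c.tgt)⁻¹ = 1 := by
    rw [transfUp_axialT_base, transfUp_axialT_base, transfUp_axialT_tgt, transfUp_axialT_tgt, hline]; group
  have hτ : ‖((transfUp (axialT U (toFine k c.src)) k c.src * (transfUp (axialT W (toFine k c.src)) k c.src)⁻¹ * transfUp (axialT W (toFine k c.src)) k c.tgt *
      (transfUp (axialT U (toFine k c.src)) k c.tgt)⁻¹ : Matrix.specialUnitaryGroup n ℂ) : Matrix n n ℂ) - 1‖ ≤ 0 := by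
    rw [hprod, OneMemClass.coe_one, sub_self, norm_zero]
  have h := norm_defect_sub_one_le_of_twoGauges hk U W (axialT U (toFine k c.src)) (axialT W (toFine k c.src)) S c (fun x hx => hx) hδ hUσ hWσ hτ hm h32 hN
  simpa only [add_zero, mul_zero] using h

/-! ## §3 With the section: the defect of the START against the datum -/

/-- **★★★ (S6), BOX FORM — THE DEFECT OF THE START AGAINST THE DATUM IS `O(D·L^k·b′) = O(ε)`**: with `W := iterSec k V` (exact: `avg^k(iterSec k V) = V`) the bound of §2 reads
`‖avg^k U(c)·V(c)* − 1‖ ≤ 2(d+1)L^k·(D·b′)`; for START v3 `b′ = 64εL^{−2k}`, `D ≤ 2dL^k`: `≤ 256(d+1)d·ε`, k-free — the `(U₀, η₀ = O(ε))` input of the regional Newton shell.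
[cite: Balaban1985Variational, Thm 1 (8) p.279, (11)–(13) pp.279–280; Balaban1985Averaging, Prop. 4 (134)–(135) p.38, pp.24–25; Balaban1987RG1, (0.11) p.253] -/
theorem norm_startDefect_sub_one_le_of_box {k : ℕ} (hk : k ≤ P.m + P.K) (U : GaugeField P 0 (Matrix.specialUnitaryGroup n ℂ)) (V : GaugeField P k (Matrix.specialUnitaryGroup n ℂ))
    (c : PBond P k) {I : Fin P.d → Set (ZMod (P.sitesPerDir 0))} {b' : ℝ} (hb' : 0 ≤ b') {D : ℕ}
    (hU : ∀ q : Plaq P 0, q.src ∈ {z : Site P 0 | ∀ κ, z κ ∈ I κ} → (q.src.shift q.μ).shift q.ν ∈ {z : Site P 0 | ∀ κ, z κ ∈ I κ} → dist1 (GaugeField.plaqHol U q) ≤ b')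
    (hW : ∀ q : Plaq P 0, q.src ∈ {z : Site P 0 | ∀ κ, z κ ∈ I κ} → (q.src.shift q.μ).shift q.ν ∈ {z : Site P 0 | ∀ κ, z κ ∈ I κ} →
      dist1 (GaugeField.plaqHol (iterSec k V) q) ≤ 0)
    (hwrap : ∀ x : Site P 0, (iterBlockOf k x = c.src ∨ iterBlockOf k x = c.tgt) → ∀ μ : Fin P.d, (rel (toFine k c.src) x μ + 1) * 2 ≤ (P.sitesPerDir 0 : ℤ))
    (hfan : ∀ x : Site P 0, (iterBlockOf k x = c.src ∨ iterBlockOf k x = c.tgt) → ∀ μ : Fin P.d, (iterBlockOf k (x.shift μ) = c.src ∨ iterBlockOf k (x.shift μ) = c.tgt) →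
      ∀ (κ : Fin P.d) (t : ℤ), min 0 (min (rel (toFine k c.src) x κ) ((rel (toFine k c.src) x + e μ) κ)) ≤ t →
        t ≤ max 0 (max (rel (toFine k c.src) x κ) ((rel (toFine k c.src) x + e μ) κ)) → (toFine k c.src) κ + ((t : ℤ) : ZMod (P.sitesPerDir 0)) ∈ I κ)
    (hl1 : ∀ x : Site P 0, (iterBlockOf k x = c.src ∨ iterBlockOf k x = c.tgt) → l1 (rel (toFine k c.src) x) ≤ D)
    (hline : axialT U (toFine k c.src) (toFine k c.tgt) = axialT (iterSec k V) (toFine k c.src) (toFine k c.tgt))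
    (hm : (((P.d : ℝ) + 1) * ((18 : ℝ) ^ P.d * (2 + ((P.d : ℝ) + 1) * (18 : ℝ) ^ P.d)) * (324 * (((P.d + 2) * P.L : ℕ) : ℝ) ^ 2) /
        ((P.L : ℝ) * ((P.L : ℝ) - 1))) * (((P.d : ℝ) + 1) * (P.L : ℝ) ^ k * ((D : ℝ) * b')) ≤ 1)
    (h32 : 32 * (((P.d + 2) * P.L : ℕ) : ℝ) * (((P.d : ℝ) + 1) * (P.L : ℝ) ^ k * ((D : ℝ) * b')) ≤ 1)
    (hN : 4 * (((P.d + 2) * P.L : ℕ) : ℝ) * (((P.d : ℝ) + 1) * (P.L : ℝ) ^ k * ((D : ℝ) * b')) < deltaSU n) :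
    ‖((Averaging.iter (fun i => (blockAvg (expMeanLogSU (n := n)) : Averaging P i (Matrix.specialUnitaryGroup n ℂ))) k U c : Matrix.specialUnitaryGroup n ℂ) : Matrix n n ℂ) *
        star ((V c : Matrix.specialUnitaryGroup n ℂ) : Matrix n n ℂ) - 1‖ ≤ 2 * (((P.d : ℝ) + 1) * (P.L : ℝ) ^ k * ((D : ℝ) * b')) := by
  have hsec : Averaging.iter (fun i => (blockAvg (expMeanLogSU (n := n)) : Averaging P i (Matrix.specialUnitaryGroup n ℂ))) k (iterSec k V) = V :=
    iter_iterSec (expMeanLogSU (n := n)) expMeanLogSU_E_one k hk V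
  have h := norm_defect_sub_one_le_of_box hk U (iterSec k V) c hb' hU hW hwrap hfan hl1 hline hm h32 hN
  rw [hsec] at h
  exact h

end SU

end Summit.QuantumFields.YangMills.Theorems.StartDefectBox

end
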